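import Summits.BirchSwinnertonDyer.BirchSwinnertonDyer.Theorems.AlignedTransportAtTwoMainConjectureOfRankZeroBSDAtTwoSelmerLayerMuDoorDescentBase
import Summits.BirchSwinnertonDyer.BirchSwinnertonDyer.Theorems.ByReductionTypeAtTwoTowerLayerCert
import HarnessLib

/-!
# Route `AlignedTransportAtTwo`, crux C2 `MainConjectureOfRankZeroBSDAtTwo` (stmt-BirchSwinnertonDyer-22298):
# THE TOWER ROAD'S GAP CERTIFICATE WITH ITS LOWER LAYER DISCHARGED BY THE SEED'S OWN `BSD₂` DATUM —
# `towerGapAtTwo_of_layerSelmer_cert` at `(j, j') = (0, k)` needs no kit count at the base: `#Ш(E/ℚ)[2] ≥ 4` when `2 ∣ #Ш_an`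

HONEST FRAMING (cell `bsd-f1-sign2`, WIDTH-5 attached prover seat `bsd-line-att-p5` gen 44 on line `birth` of the lead
`bsd-line-att-p2`; `--supports` stmt-BirchSwinnertonDyer-22298, closes nothing; BSD is NOT proved by any of this; the crux C2,
its verdict «blocked-on `Rank1Residual.GreenbergMuConjectureIrreducible`» and every registered stub are untouched). THEOREMS ONLY —
no `def`, no instance, no named fact, no `sorry`. PLACEMENT: COROLLARY-OF-TREE — a plug between this cell's TOWER road (att-p4 /
cell `bsd-2adic`: `KatoHalfPinch.towerGapAtTwo_of_layerSelmer_cert`, the door behind the `Theorems/ByReductionTypeAtTwoTowerClass*.lean`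
instance files, whose layer hypotheses `hlow`/`hup` are kit-certified counts `Nat.card {z : W.selmerLayer κ j // 2 • z = 0}`) and the
lineage's descent currency (`…SelmerLayerMuDoorDescent{,Base}`).

* ★★ `towerGapAtTwo_of_descent_cert_of_shaAn_even` — the TOWER gap certificate `X5.O1.TowerGapAtTwo W` for a seed (`W/ℚ` globally minimal,
  good ordinary at `2`, no rational point of order `2`, `r_an = 0`, `BSD₂(W)`, `#Ш_an = q` with `ord₂ q ≠ 0`) from the road's PRINT binders
  (`h33g`, `hM`, `hA`, `hS34`), its explicit local constants (`P`, `C`, `e`, `k`) and ONE upper count in DESCENT currency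
  `#Sel^(2)(E/ℚ_{j'}) ≤ 2^d` (per cyclotomic presentation), with the arithmetic side condition
  `2^d · 4 · ∏_{ℓ ∈ P} C_ℓ^{2^{min(j', e_ℓ)}} < 2^{2^{j'} + 1}`: the LOWER layer is `j = 0` with `a = 2`, supplied by
  `#{z ∈ Sel_0 | 2z = 0} = #Ш(E/ℚ)[2] ≥ 4` (Cauchy + Cassels–Tate under `BSD₂`, tree `four_le_natCard_sha_torsionBy_two_of_bsdp`) — no kit
  count at the base, and the binder `htors` (`2 ∤ #E(ℚ)_tors`) discharged from «no rational `2`-torsion abscissa».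
* `towerGapAtTwo_of_descent_cert` — the same door at a general pair `j ≤ j'` with BOTH counts in descent currency
  (`2^a ≤ #Sel^(2)(E/ℚ_j)`, `#Sel^(2)(E/ℚ_{j'}) ≤ 2^d`).
* ★★ `mazurMainConjecture_two_of_descent_cert_of_shaAn_even` — composed with att-p3 g13's per-curve closer
  `SeedKernelEC.mazurMainConjecture_two_of_bsdp_of_towerGap`: **`MazurMainConjecture W 2` for a Ш-nontrivial seed from PRINT₄ {Kato 17.4
  (1)(2) at `2`, period unit, modularity, GZK} + the road's PRINT binders and explicit local constants + ONE `2`-descent count over `ℚ_{j'}`**.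
  CONDITIONAL on the displayed PRINT; BSD is not proved by this.

References: R. Greenberg, LNM 1716 (1999), §3 Lemmas 3.3–3.5, §4 [GreenbergLNM1716]; J. H. Silverman, GTM 106, X.4.2 [SilvermanAEC2009];
J. W. S. Cassels, Arithmetic on curves of genus 1, IV [Cassels1962ArithmeticIV]; R. L. Miller, LMS J. Comput. Math. 14 (2011), Def. 1.1
[Miller2011LMS].
-/

set_option linter.dupNamespace false
set_option autoImplicit false

noncomputable section

open scoped Classical AddSubgroup MatrixGroups ModularForm

namespace Summit.BirchSwinnertonDyer.BirchSwinnertonDyer.Theorems.AlignedTransportAtTwoSelmerLayerMuDoorDescentTowerCert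

open CongruenceSubgroup WeierstrassCurve Literature.NumberTheory.EllipticCurves Literature.NumberTheory.EllipticCurves.Greenberg1999
  Literature.NumberTheory.EllipticCurves.ModularForms
  Literature.NumberTheory.EllipticCurves.Rank1Residual Literature.NumberTheory.EllipticCurves.Rank1Residual.Typed
  Summit.BirchSwinnertonDyer.Rank1Residual.X5.O1
  Summit.BirchSwinnertonDyer.BirchSwinnertonDyer.Theorems.Rank1ResidualX1Defs
  Summit.BirchSwinnertonDyer.BirchSwinnertonDyer.Theorems.AlignedTransportAtTwoSeedKernelEC
  Summit.BirchSwinnertonDyer.BirchSwinnertonDyer.Theorems.KatoHalfPinch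
  Summit.BirchSwinnertonDyer.BirchSwinnertonDyer.Theorems.AlignedTransportAtTwoSelmerTwoOfBSDp
  Summit.BirchSwinnertonDyer.BirchSwinnertonDyer.Theorems.AlignedTransportAtTwoCubicClassNumberParityOfLValue
  Summit.BirchSwinnertonDyer.BirchSwinnertonDyer.Theorems.AlignedTransportAtTwoSelmerLayerMuDoorTowerCurrency
  Summit.BirchSwinnertonDyer.BirchSwinnertonDyer.Theorems.AlignedTransportAtTwoSelmerLayerMuDoorDescent
  Summit.BirchSwinnertonDyer.BirchSwinnertonDyer.Theorems.AlignedTransportAtTwoSelmerLayerMuDoorDescentBase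

variable (W : WeierstrassCurve ℚ) [W.IsElliptic] [W.IsGloballyMinimal]

omit [W.IsGloballyMinimal] in
/-- **`2 ∤ #E(ℚ)_tors` from «no rational `2`-torsion abscissa»** (`E[2]` irreducible ⟹ `ord₂ #E(ℚ)_tors = 0`, tree
`padicValNat_torsionOrder_eq_zero_of_irreducible`; `#E(ℚ)_tors ≥ 1`). [cite: SilvermanAEC2009, VII.3.4 and §III.2] -/
theorem not_two_dvd_torsionOrder (ht : ∀ x : ℚ, ¬ HasRationalTwoTorsionX W x) : ¬ 2 ∣ W.torsionOrder := by
  haveI : Fact (Nat.Prime 2) := Nat.fact_prime_two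
  have h0 := padicValNat_torsionOrder_eq_zero_of_irreducible W 2 (irr_two_of_forall_not_hasRationalTwoTorsionX W ht)
  have hpos : 0 < W.torsionOrder := W.torsionOrder_pos_holds
  rcases padicValNat.eq_zero_iff.mp h0 with h | h | h
  · exact absurd h (by norm_num)
  · exact absurd h hpos.ne'
  · exact h

/-- **The TOWER gap certificate with BOTH layer counts in DESCENT currency.** `KatoHalfPinch.towerGapAtTwo_of_layerSelmer_cert` with its
kit-currency hypotheses `2^a ≤ #{z ∈ Sel_j | 2z = 0}`, `#{z ∈ Sel_{j'} | 2z = 0} ≤ 2^d` replaced by `2^a ≤ #Sel^(2)(E/ℚ_j)`,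
`#Sel^(2)(E/ℚ_{j'}) ≤ 2^d` — the orders of the `2`-Selmer groups of `2`-descents over the layer number fields (valid on the cell, no
rational point of order `2`: `…DescentBase.natCard_subtype_two_nsmul_selmerLayer_eq_natCard_selmerGroup`); `htors` discharged from `ht`.
PRINT binders `h33g`/`hM`/`hA`/`hS34` and the explicit local data exactly as in the road. [cite: GreenbergLNM1716, §3 Lemmas 3.3–3.5]
[cite: SilvermanAEC2009, Thm. X.4.2] -/
theorem towerGapAtTwo_of_descent_cert
    (h33g : lemma33_localTowerKerPrimary_eq_bot_of_good.{0})
    (hM : lemma33_localTowerKerPrimary_cyclic_of_multiplicative.{0})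
    (hA : lemma33_natCard_localTowerKerPrimary_le_four_of_additive.{0})
    (hS34 : lemma34_localTowerKerPrimary_cyclicExtension_rat)
    (hord : IsOrdinaryAt W 2) (ht : ∀ x : ℚ, ¬ HasRationalTwoTorsionX W x) {j j' a d : ℕ} (hjj' : j ≤ j')
    (P : Finset ℕ) (hP : ∀ ℓ ∈ P, ℓ.Prime ∧ ℓ ≠ 2)
    (hΔ : ∀ ℓ : ℕ, ℓ.Prime → ℓ ≠ 2 → (ℓ : ℤ) ∣ W.minimalDiscriminantInt → ℓ ∈ P)
    (C e k : ℕ → ℕ) (he : ∀ ℓ ∈ P, ¬ 2 ^ (e ℓ + 4) ∣ ℓ ^ 2 - 1)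
    (hC : ∀ (ℓ : ℕ) [Fact ℓ.Prime], ℓ ∈ P →
      4 ≤ C ℓ ∨ (W.HasMultiplicativeReductionAtPrime ℓ ∧ 2 ≤ C ℓ) ∨
        (W.HasMultiplicativeReductionAtPrime ℓ ∧ (ℓ : ℤ) ^ k ℓ ∣ W.minimalDiscriminantInt ∧
          ¬ (ℓ : ℤ) ^ (k ℓ + 1) ∣ W.minimalDiscriminantInt ∧ ¬ 2 ∣ k ℓ ∧ 1 ≤ C ℓ) ∨
        (¬ (ℓ : ℤ) ∣ W.minimalDiscriminantInt ∧ 1 ≤ C ℓ))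
    (hlow : ∀ κ : ZpExtension ℚ 2, κ.IsCyclotomic → 2 ^ a ≤ Nat.card ((W.baseChange (κ.layer j)).selmerGroup 2))
    (hup : ∀ κ : ZpExtension ℚ 2, κ.IsCyclotomic → Nat.card ((W.baseChange (κ.layer j')).selmerGroup 2) ≤ 2 ^ d)
    (harith : 2 ^ d * 4 * ∏ ℓ ∈ P, C ℓ ^ 2 ^ min j' (e ℓ) < 2 ^ (2 ^ j' - 2 ^ j + a)) :
    TowerGapAtTwo W :=
  towerGapAtTwo_of_layerSelmer_cert W h33g hM hA hS34 hord (not_two_dvd_torsionOrder W ht) hjj' P hP hΔ C e k he hC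
    (fun κ hκ ↦ by rw [natCard_subtype_two_nsmul_selmerLayer_eq_natCard_selmerGroup W ht κ j]; exact hlow κ hκ)
    (fun κ hκ ↦ by rw [natCard_subtype_two_nsmul_selmerLayer_eq_natCard_selmerGroup W ht κ j']; exact hup κ hκ) harith

/-- ★★ **THE TOWER GAP CERTIFICATE WITH THE BASE LAYER PAID BY `BSD₂`.** For a seed — `W/ℚ` globally minimal, good ordinary at `2`, no
rational point of order `2`, `r_an(W) = 0`, `BSD₂(W)`, `#Ш_an(W) = q` with `ord₂ q ≠ 0` — the road's PRINT binders and explicit local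
data, and ONE upper count `#Sel^(2)(E/ℚ_{j'}) ≤ 2^d` in descent currency (per cyclotomic presentation): if
`2^d · 4 · ∏_{ℓ ∈ P} C_ℓ^{2^{min(j', e_ℓ)}} < 2^{2^{j'} + 1}` then `X5.O1.TowerGapAtTwo W`. The lower layer is `j = 0` with `a = 2`:
`#Sel^(2)(E/ℚ) = #Ш(E/ℚ)[2] ≥ 4` from the seed's own `BSD₂` datum (Cauchy in `Ш[2^∞]` + Cassels–Tate; no kit count at the base).
E.g. `j' = 2` (`ℚ(ζ₁₆)⁺`): `2^d · 4 · ∏ C_ℓ^{…} < 32`. [cite: GreenbergLNM1716, §3 Lemmas 3.3–3.5, §4] [cite: Cassels1962ArithmeticIV, Thm. 1.1]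
[cite: Miller2011LMS, Def. 1.1] [cite: SilvermanAEC2009, Thm. X.4.2] -/
theorem towerGapAtTwo_of_descent_cert_of_shaAn_even
    (h33g : lemma33_localTowerKerPrimary_eq_bot_of_good.{0})
    (hM : lemma33_localTowerKerPrimary_cyclic_of_multiplicative.{0})
    (hA : lemma33_natCard_localTowerKerPrimary_le_four_of_additive.{0})
    (hS34 : lemma34_localTowerKerPrimary_cyclicExtension_rat)
    (hord : IsOrdinaryAt W 2) (ht : ∀ x : ℚ, ¬ HasRationalTwoTorsionX W x)
    (hbsd : BSDp W 2) (hr : W.analyticRank = 0) {q : ℚ} (hq : shaAn W = (q : ℂ)) (hv : padicValRat 2 q ≠ 0)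
    {j' d : ℕ} (P : Finset ℕ) (hP : ∀ ℓ ∈ P, ℓ.Prime ∧ ℓ ≠ 2)
    (hΔ : ∀ ℓ : ℕ, ℓ.Prime → ℓ ≠ 2 → (ℓ : ℤ) ∣ W.minimalDiscriminantInt → ℓ ∈ P)
    (C e k : ℕ → ℕ) (he : ∀ ℓ ∈ P, ¬ 2 ^ (e ℓ + 4) ∣ ℓ ^ 2 - 1)
    (hC : ∀ (ℓ : ℕ) [Fact ℓ.Prime], ℓ ∈ P →
      4 ≤ C ℓ ∨ (W.HasMultiplicativeReductionAtPrime ℓ ∧ 2 ≤ C ℓ) ∨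
        (W.HasMultiplicativeReductionAtPrime ℓ ∧ (ℓ : ℤ) ^ k ℓ ∣ W.minimalDiscriminantInt ∧
          ¬ (ℓ : ℤ) ^ (k ℓ + 1) ∣ W.minimalDiscriminantInt ∧ ¬ 2 ∣ k ℓ ∧ 1 ≤ C ℓ) ∨
        (¬ (ℓ : ℤ) ∣ W.minimalDiscriminantInt ∧ 1 ≤ C ℓ))
    (hup : ∀ κ : ZpExtension ℚ 2, κ.IsCyclotomic → Nat.card ((W.baseChange (κ.layer j')).selmerGroup 2) ≤ 2 ^ d)
    (harith : 2 ^ d * 4 * ∏ ℓ ∈ P, C ℓ ^ 2 ^ min j' (e ℓ) < 2 ^ (2 ^ j' + 1)) :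
    TowerGapAtTwo W := by
  have hr0 : W.mordellWeilRank = 0 := mordellWeilRank_eq_zero_of_bsdp W hbsd hr
  have h4 : 4 ≤ Nat.card ((↥W.sha)[(2 : ℤ)]) := by exact_mod_cast four_le_natCard_sha_torsionBy_two_of_bsdp W hbsd hq hv
  have hexp : 2 ^ j' - 2 ^ 0 + 2 = 2 ^ j' + 1 := by
    have h1 : 1 ≤ 2 ^ j' := Nat.one_le_two_pow
    rw [pow_zero]; omega
  refine towerGapAtTwo_of_descent_cert W h33g hM hA hS34 hord ht (Nat.zero_le j') P hP hΔ C e k he hC (a := 2)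
    (fun κ _ ↦ ?_) hup (by rw [hexp]; exact harith)
  rw [natCard_selmerGroup_two_layer_eq W ht κ 0, natCard_torsionBy_selmerLayer_zero_two_eq_natCard_sha W hr0 κ]
  simpa using h4

/-- ★★ **MAZUR'S `2`-ADIC MAIN CONJECTURE FOR A Ш-NONTRIVIAL SEED FROM PRINT + EXPLICIT LOCAL CONSTANTS + ONE `2`-DESCENT COUNT.**
`towerGapAtTwo_of_descent_cert_of_shaAn_even` composed with att-p3 g13's per-curve closer
`SeedKernelEC.mazurMainConjecture_two_of_bsdp_of_towerGap`: for `W/ℚ` globally minimal, good ordinary at `2`, no rational point of order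
`2`, `r_an = 0`, `BSD₂(W)`, `#Ш_an = q` with `ord₂ q ≠ 0`, granted PRINT₄ {Kato 17.4 (1)(2) at `2` (`h17`), the period unit (`hper`),
modularity (`hmod`), GZK (`hGZK`)} and the TOWER road's PRINT binders (`h33g`, `hM`, `hA`, `hS34`): ONE count `#Sel^(2)(E/ℚ_{j'}) ≤ 2^d` per
cyclotomic presentation with `2^d · 4 · ∏_{ℓ ∈ P} C_ℓ^{2^{min(j', e_ℓ)}} < 2^{2^{j'} + 1}` gives `MazurMainConjecture W 2`. CONDITIONAL on
the displayed PRINT; closes nothing by itself. [cite: Kato2004Asterisque, Thm. 17.4 (1)(2) (p. 273)] [cite: GreenbergLNM1716, §3–§4]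
[cite: Miller2011LMS, Def. 1.1] -/
theorem mazurMainConjecture_two_of_descent_cert_of_shaAn_even
    (h17 : ∀ [NeZero (W.conductorNorm ℤ)] (f : CuspForm (Gamma0 (W.conductorNorm ℤ)) 2),
      kato_divisibility_allPrimes W 2 (f := f))
    (hper : realPeriodRat_eq_unit_mul_plusPeriod_two) (hmod : nonempty_modularParametrizationData)
    (hGZK : rank_eq_analyticRank_of_analyticRank_le_one)
    (h33g : lemma33_localTowerKerPrimary_eq_bot_of_good.{0})
    (hM : lemma33_localTowerKerPrimary_cyclic_of_multiplicative.{0})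
    (hA : lemma33_natCard_localTowerKerPrimary_le_four_of_additive.{0})
    (hS34 : lemma34_localTowerKerPrimary_cyclicExtension_rat)
    (hord : IsOrdinaryAt W 2) (ht : ∀ x : ℚ, ¬ HasRationalTwoTorsionX W x)
    (hbsd : BSDp W 2) (hr : W.analyticRank = 0) {q : ℚ} (hq : shaAn W = (q : ℂ)) (hv : padicValRat 2 q ≠ 0)
    {j' d : ℕ} (P : Finset ℕ) (hP : ∀ ℓ ∈ P, ℓ.Prime ∧ ℓ ≠ 2)
    (hΔ : ∀ ℓ : ℕ, ℓ.Prime → ℓ ≠ 2 → (ℓ : ℤ) ∣ W.minimalDiscriminantInt → ℓ ∈ P)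
    (C e k : ℕ → ℕ) (he : ∀ ℓ ∈ P, ¬ 2 ^ (e ℓ + 4) ∣ ℓ ^ 2 - 1)
    (hC : ∀ (ℓ : ℕ) [Fact ℓ.Prime], ℓ ∈ P →
      4 ≤ C ℓ ∨ (W.HasMultiplicativeReductionAtPrime ℓ ∧ 2 ≤ C ℓ) ∨
        (W.HasMultiplicativeReductionAtPrime ℓ ∧ (ℓ : ℤ) ^ k ℓ ∣ W.minimalDiscriminantInt ∧
          ¬ (ℓ : ℤ) ^ (k ℓ + 1) ∣ W.minimalDiscriminantInt ∧ ¬ 2 ∣ k ℓ ∧ 1 ≤ C ℓ) ∨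
        (¬ (ℓ : ℤ) ∣ W.minimalDiscriminantInt ∧ 1 ≤ C ℓ))
    (hup : ∀ κ : ZpExtension ℚ 2, κ.IsCyclotomic → Nat.card ((W.baseChange (κ.layer j')).selmerGroup 2) ≤ 2 ^ d)
    (harith : 2 ^ d * 4 * ∏ ℓ ∈ P, C ℓ ^ 2 ^ min j' (e ℓ) < 2 ^ (2 ^ j' + 1)) :
    MazurMainConjecture W 2 :=
  mazurMainConjecture_two_of_bsdp_of_towerGap W h17 hper hmod hGZK hord ht hr hbsd
    (towerGapAtTwo_of_descent_cert_of_shaAn_even W h33g hM hA hS34 hord ht hbsd hr hq hv P hP hΔ C e k he hC hup harith)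

end Summit.BirchSwinnertonDyer.BirchSwinnertonDyer.Theorems.AlignedTransportAtTwoSelmerLayerMuDoorDescentTowerCert

end
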